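import Summits.BirchSwinnertonDyer.BirchSwinnertonDyer.Theorems.GenusKolyvaginAtTwoGenusPrimitiveSupplyAtTwoHeegnerTwinTamagawa
import Summits.BirchSwinnertonDyer.Rank1Residual.X11b.TwistTransportRam
import Literature.NumberTheory.EllipticCurves.PAdicLFunctionQuadraticTwistBirchSharedPrimesProofs
import Literature.NumberTheory.QuadraticFields.FundamentalDiscriminant
import HarnessLib

/-!
# Route `GenusKolyvaginAtTwo`, crux `GenusPrimitiveSupplyAtTwo` (stmt-BirchSwinnertonDyer-22136):
# the Tamagawa parity of a Heegner twin — `Tam(E^{(d_K)})` is odd iff `Tam(E)` is odd and every prime of `d_K` is silent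

Seat `bsd-line-gk2-p5` g2 (cell `bsd-f1-sign2`), SUPPLY lineage; third file of the Heegner-twin series
(`…HeegnerTwinParity.lean`: `(Δ_min | |d_K|) = sign Δ_min`; `…HeegnerTwinTamagawa.lean`: `Δ < 0 ⇒ Tam(E^{(d_K)})` even).
Summit-side THEOREM-ONLY file (no definition, no named fact, no `sorry`), `--supports stmt-BirchSwinnertonDyer-22136`.

WHAT. `W/ℚ` globally minimal, `K` imaginary quadratic with ODD `d_K` and the Heegner hypothesis for `N_W`, `Wd` any
`ℚ`-model of `W^{(d_K)}`, `ψ = 4x³ + b₂x² + 2b₄x + b₆` the `2`-division cubic of the minimal model: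
* §7 `localTamagawaNumber_twin_eq_of_dvd_conductorNorm` — `c_ℓ(Wd) = c_ℓ(W)` at `ℓ ∣ N` (`d_K ∈ (ℚ_ℓ^×)²`);
* §8 `hasGoodReductionAtPrime_twist_of_not_dvd`, `localTamagawaNumber_twist_eq_one_of_not_dvd` — for `d ≡ 1 (mod 4)` a model
  of `W^{(d)}` is good, `c_p = 1`, at every good `p ∤ d` of `W` (including `p = 2`; conductor exponents agree off `d`);
* §9 `localTamagawaNumber_twist_eq_one_of_no_root` — `q ∥ d`, `q ∤ 2Δ_min`, `ψ` has NO root mod `q` ⇒ `c_q(Wd) = 1`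
  (silent prime, `I₀*` with irreducible cubic; companion of `two_dvd_localTamagawaNumber_twist_of_root`);
* §10 **`odd_tamagawaProduct_twin_iff`: `Odd Tam(Wd) ↔ Odd Tam(W) ∧ ∀ q ∣ d_K, ψ has no root mod q`** — the census formula
  `c_q(E^{(d_K)}) = 1 + #{roots of ψ mod q}` of TWIN-TAM-W52D (gk2-p4) in parity, as a theorem;
* USE (no Theses import here, to stay outside every route cone): with gk2-p4's bridge
  `MinimalTwinBSDTwo.bsdp_two_heegnerTwin_of_rankOneAtTwoBigImageOddLocal h W hρ K Wd ⟨Cd, hWd⟩ hcmd hTd hard`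
  (`Theorems/GenusKolyvaginAtTwoMinimalTwinBSDTwoBridges.lean`), feed `hTd := (odd_tamagawaProduct_twin_iff W hK hodd hH Cd
  hWd).mpr ⟨hTW, hsilent⟩`: granted item 23715, `BSD₂` of the rank-one twin on the all-silent slice, by name.

WHY (planner-facing). With the two companions this pins the «odd-Tamagawa twin» option of the route's glue exactly: for a
habitat curve (`Tam(E)` odd) the supplied twin `E^{(d_K)}` has odd Tamagawa product iff every prime of `d_K` is silent,
which forces `Δ_E > 0` (`Δ_pos_of_odd_tamagawaProduct_twin`: for `Δ_E < 0` a transposition prime always divides `d_K`).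
So a restatement «DEF(E,K) = 1» (gk2-p2 g4) on the `Δ_E > 0` cells is the all-silent clause, served by 23715 by name;
on `Δ_E < 0` cells the rank-one input stays crux #6 / the residual. No item is closed; BSD is not proved by this.

References: [SilvermanAEC2009] III.1, VII.6 Ex. 7.6, X.5 Cor. 5.4; [SilvermanATAEC1994] IV.9.4 Step 6;
[BoxerDiao2010] proof of Prop. 4.1 (p. 1977).
-/
set_option linter.dupNamespace false -- tree convention: `Summit.BirchSwinnertonDyer.BirchSwinnertonDyer.Theorems` (summit = sub-problem)
set_option autoImplicit false

noncomputable section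

open scoped Classical

open IsLocalRing NumberField WeierstrassCurve Literature.NumberTheory.EllipticCurves Rat.HeightOneSpectrum

namespace Summit.BirchSwinnertonDyer.BirchSwinnertonDyer.Theorems.GenusKolyTwin

/-! ## §7. `c_ℓ(E^{(d_K)}) = c_ℓ(E)` at the primes `ℓ ∣ N` (they split in `K`) -/

/-- **At a prime `ℓ` of the conductor, `c_ℓ(Wd) = c_ℓ(W)` for every model `Wd` of the Heegner twist `W^{(d_K)}`**: under
the Heegner hypothesis `d_K` is a square in `ℚ_ℓ` (`X11b.isSquare_discr_padic_of_heegner`), so `Wd ⊗ ℚ_ℓ ≅ W ⊗ ℚ_ℓ`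
(`exists_variableChange_smul_eq_quadraticTwist_sq`) and `c_ℓ` is an isomorphism invariant (the `ℓ ∣ N` half of the
tree's `X11b.padicValNat_localTamagawaNumber_twist_eq`, stated as an equality). [cite: SilvermanAEC2009, VII.6 Ex. 7.6 and X.5 Cor. 5.4] -/
theorem localTamagawaNumber_twin_eq_of_dvd_conductorNorm (W : WeierstrassCurve ℚ) [W.IsElliptic]
    {K : Type} [Field K] [NumberField K] (hK : IsImaginaryQuadratic K)
    (hH : SatisfiesHeegnerHypothesis (W.conductorNorm ℤ) K) {Wd : WeierstrassCurve ℚ} [Wd.IsElliptic]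
    (Cd : VariableChange ℚ) (hWd : Cd • W.quadraticTwist (discr K : ℚ) = Wd) (ℓ : ℕ) [Fact ℓ.Prime]
    (hℓN : ℓ ∣ W.conductorNorm ℤ) :
    (Wd.baseChange ℚ_[ℓ]).localTamagawaNumber ℤ_[ℓ] = (W.baseChange ℚ_[ℓ]).localTamagawaNumber ℤ_[ℓ] := by
  have hD0 : (discr K : ℚ) ≠ 0 := by exact_mod_cast NumberField.discr_ne_zero K
  haveI : (W.baseChange ℚ_[ℓ]).IsElliptic := inferInstanceAs (W.map (algebraMap ℚ ℚ_[ℓ])).IsElliptic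
  haveI : (Wd.baseChange ℚ_[ℓ]).IsElliptic := inferInstanceAs (Wd.map (algebraMap ℚ ℚ_[ℓ])).IsElliptic
  obtain ⟨θ, hθ⟩ := Summit.BirchSwinnertonDyer.Rank1Residual.X11b.isSquare_discr_padic_of_heegner K hK hH ℓ hℓN
  have hθ0 : θ ≠ 0 := by
    rintro rfl
    exact (map_ne_zero (algebraMap ℚ ℚ_[ℓ])).mpr hD0 (hθ.trans (mul_zero 0))
  obtain ⟨C, hC⟩ := (W.baseChange ℚ_[ℓ]).exists_variableChange_smul_eq_quadraticTwist_sq hθ0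
  have h1 : (W.quadraticTwist (discr K : ℚ)).baseChange ℚ_[ℓ] = C • W.baseChange ℚ_[ℓ] := by
    rw [hC, baseChange, baseChange, map_quadraticTwist, hθ, sq]
  have hYX : Wd.baseChange ℚ_[ℓ] = (Cd.baseChange ℚ_[ℓ] * C) • W.baseChange ℚ_[ℓ] := by
    rw [← hWd, WeierstrassCurve.baseChange_smul_eq, h1, mul_smul]
  exact localTamagawaNumber_eq_of_eq_smul ℓ _ hYX

/-! ## §8. `c_ℓ(E^{(d)}) = 1` off `N·d` (`d ≡ 1 mod 4`) -/

/-- **A model of `W^{(d)}` (`d ≡ 1 (mod 4)`) has good reduction at every prime `p ∤ d` of good reduction of `W`** — also at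
`p = 2`: the conductor exponents of `W` and `W^{(d)}` agree at the places prime to `d`
(`factorization_conductorNorm_quadraticTwist_eq_of_not_dvd`, via the `2`-integral twist model `W.twistModel ((d−1)/4)`).
[cite: SilvermanATAEC1994, IV.9.4 (PDF pp. 344–346)] -/
theorem hasGoodReductionAtPrime_twist_of_not_dvd (W : WeierstrassCurve ℚ) [W.IsElliptic] {d : ℤ} (hd4 : d % 4 = 1)
    {Wd : WeierstrassCurve ℚ} [Wd.IsElliptic] (Cd : VariableChange ℚ) (hWd : Cd • W.quadraticTwist (d : ℚ) = Wd)
    (p : ℕ) [Fact p.Prime] (hgood : W.HasGoodReductionAtPrime p) (hpd : ¬ (p : ℤ) ∣ d) :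
    Wd.HasGoodReductionAtPrime p := by
  have hp : p.Prime := Fact.out
  have hd0 : (d : ℚ) ≠ 0 := by exact_mod_cast (show d ≠ 0 by rintro rfl; norm_num at hd4)
  haveI := W.isElliptic_quadraticTwist hd0
  have hpN : ¬ p ∣ W.conductorNorm ℤ := fun h ↦ (W.dvd_conductorNorm_iff_not_hasGoodReductionAtPrime p).mp h hgood
  set vp : IsDedekindDomain.HeightOneSpectrum ℤ := (primesEquiv (R := ℤ)).symm ⟨p, hp⟩ with hvp
  have hgenp : natGenerator vp = p :=
    congrArg (fun q : Nat.Primes ↦ (q : ℕ)) ((primesEquiv (R := ℤ)).apply_symm_apply ⟨p, hp⟩)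
  have hfac := W.factorization_conductorNorm_quadraticTwist_eq_of_not_dvd hd4 vp (by rw [hgenp]; exact hpd)
  rw [hgenp] at hfac
  have hNA : Wd.conductorNorm ℤ = (W.quadraticTwist (d : ℚ)).conductorNorm ℤ := by
    rw [← hWd]; exact WeierstrassCurve.conductorNorm_smul ℤ _ Cd
  have hpNA : ¬ p ∣ Wd.conductorNorm ℤ := by
    intro h
    rw [hNA] at h
    have hpos : 0 < ((W.quadraticTwist (d : ℚ)).conductorNorm ℤ).factorization p :=
      Nat.Prime.factorization_pos_of_dvd hp ((W.quadraticTwist (d : ℚ)).conductorNorm_pos_holds).ne' h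
    rw [hfac] at hpos
    exact hpN (Nat.dvd_of_factorization_pos (Nat.pos_iff_ne_zero.mp hpos))
  by_contra h
  exact hpNA ((Wd.dvd_conductorNorm_iff_not_hasGoodReductionAtPrime p).mpr h)

/-- `c_p(Wd) = 1` at such a prime (good reduction). [cite: SilvermanAEC2009, VII.6 (c_p = 1 at good reduction)] -/
theorem localTamagawaNumber_twist_eq_one_of_not_dvd (W : WeierstrassCurve ℚ) [W.IsElliptic] {d : ℤ} (hd4 : d % 4 = 1)
    {Wd : WeierstrassCurve ℚ} [Wd.IsElliptic] (Cd : VariableChange ℚ) (hWd : Cd • W.quadraticTwist (d : ℚ) = Wd)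
    (p : ℕ) [Fact p.Prime] (hgood : W.HasGoodReductionAtPrime p) (hpd : ¬ (p : ℤ) ∣ d) :
    (Wd.baseChange ℚ_[p]).localTamagawaNumber ℤ_[p] = 1 := by
  haveI : (Wd.baseChange ℚ_[p]).IsElliptic := inferInstanceAs (Wd.map (algebraMap ℚ ℚ_[p])).IsElliptic
  haveI : ((Wd.baseChange ℚ_[p]).minimal ℤ_[p]).HasGoodReduction ℤ_[p] :=
    hasGoodReductionAtPrime_twist_of_not_dvd W hd4 Cd hWd p hgood hpd
  exact localTamagawaNumber_eq_one_of_hasGoodReduction_holds ℤ_[p] _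

/-! ## §9. `q ∥ d`, no root of the `2`-division cubic mod `q` ⇒ `c_q(E^{(d)}) = 1` -/

/-- A root `t` of the Step-6 cubic `T³ + d̄₁b̄₂T² + 8d̄₁²b̄₄T + 16d̄₁³b̄₆` in the residue field of `ℤ_q` gives the root
`x = t/(4d̄₁)` of `ψ = 4x³ + b₂x² + 2b₄x + b₆` in `ZMod q` (inverse of `exists_cubic_root_of_zmod_root`). [folklore] -/
theorem exists_zmod_root_of_cubic_root (q : ℕ) [hq : Fact q.Prime] (W : WeierstrassCurve ℚ) [W.IsGloballyMinimal]
    (hq2 : q ≠ 2) {d₁ : ℤ} (hd₁ : ¬ (q : ℤ) ∣ d₁) {t : ResidueField ℤ_[q]}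
    (ht : t ^ 3 + residue ℤ_[q] ((d₁ : ℤ_[q]) * ((integralModelInt W).b₂ : ℤ_[q])) * t ^ 2 +
        residue ℤ_[q] (8 * (d₁ : ℤ_[q]) ^ 2 * ((integralModelInt W).b₄ : ℤ_[q])) * t +
        residue ℤ_[q] (16 * (d₁ : ℤ_[q]) ^ 3 * ((integralModelInt W).b₆ : ℤ_[q])) = 0) :
    ∃ x : ZMod q, 4 * x ^ 3 + ((integralModelInt W).b₂ : ZMod q) * x ^ 2 +
      2 * ((integralModelInt W).b₄ : ZMod q) * x + ((integralModelInt W).b₆ : ZMod q) = 0 := by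
  set e : ResidueField ℤ_[q] ≃+* ZMod q := PadicInt.residueField (p := q) with he
  have hdk : ((d₁ : ℤ) : ResidueField ℤ_[q]) ≠ 0 := intCast_residueField_ne_zero q hd₁
  have h2k : ((2 : ℤ) : ResidueField ℤ_[q]) ≠ 0 := by
    refine intCast_residueField_ne_zero q fun h => hq2 ?_
    exact ((Nat.prime_dvd_prime_iff_eq hq.out Nat.prime_two).mp (by exact_mod_cast h))
  push_cast at h2k
  have h4d : (4 * (d₁ : ResidueField ℤ_[q])) ≠ 0 := by
    have : (4 : ResidueField ℤ_[q]) = 2 * 2 := by norm_num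
    rw [this]
    exact mul_ne_zero (mul_ne_zero h2k h2k) hdk
  set x : ResidueField ℤ_[q] := t * (4 * (d₁ : ResidueField ℤ_[q]))⁻¹ with hx
  have htx : t = 4 * (d₁ : ResidueField ℤ_[q]) * x := by
    rw [hx, mul_comm (4 * (d₁ : ResidueField ℤ_[q])), mul_assoc, inv_mul_cancel₀ h4d, mul_one]
  simp only [map_mul, map_pow, map_ofNat, map_intCast] at ht
  rw [htx] at ht
  have h0 : 16 * (d₁ : ResidueField ℤ_[q]) ^ 3 * (4 * x ^ 3 + ((integralModelInt W).b₂ : ResidueField ℤ_[q]) * x ^ 2 +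
      2 * ((integralModelInt W).b₄ : ResidueField ℤ_[q]) * x + ((integralModelInt W).b₆ : ResidueField ℤ_[q])) = 0 := by
    linear_combination ht
  have h16 : (16 * (d₁ : ResidueField ℤ_[q]) ^ 3) ≠ 0 := by
    have : (16 * (d₁ : ResidueField ℤ_[q]) ^ 3) = (4 * (d₁ : ResidueField ℤ_[q])) ^ 2 * (d₁ : ResidueField ℤ_[q]) := by ring
    rw [this]
    exact mul_ne_zero (pow_ne_zero _ h4d) hdk
  have hroot := (mul_eq_zero.mp h0).resolve_left h16
  refine ⟨e x, ?_⟩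
  have := congr_arg e hroot
  simpa only [map_add, map_mul, map_pow, map_ofNat, map_intCast, map_zero] using this

/-- **`q ∥ d`, `q ∤ 2Δ_min(W)`, NO root of the `2`-division cubic mod `q` ⇒ `c_q(E^{(d)}) = 1`, for ANY `ℚ`-model `Wd`
of the twist** (Kodaira type `I₀*` with irreducible cubic — a «silent prime»: Boxer–Diao 2010, proof of Prop. 4.1; the
tree's DVR lemma `LocalIndex.localTamagawaNumber_baseChange_eq_one_of_cubic_no_root` on the integer twist model of
`two_dvd_localTamagawaNumber_twist_of_root`). [cite: BoxerDiao2010, proof of Prop. 4.1 (p. 1977)]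
[cite: SilvermanATAEC1994, IV.9.4 Step 6 (PDF p. 345)] -/
theorem localTamagawaNumber_twist_eq_one_of_no_root (q : ℕ) [hq : Fact q.Prime] (hq2 : q ≠ 2)
    (W : WeierstrassCurve ℚ) [W.IsGloballyMinimal] {d d₁ : ℤ} (hd : d = q * d₁) (hd₁ : ¬ (q : ℤ) ∣ d₁)
    (hqΔ : ¬ (q : ℤ) ∣ minimalDiscriminantInt W)
    (hno : ∀ x : ZMod q, 4 * x ^ 3 + ((integralModelInt W).b₂ : ZMod q) * x ^ 2 +
      2 * ((integralModelInt W).b₄ : ZMod q) * x + ((integralModelInt W).b₆ : ZMod q) ≠ 0)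
    {Wd : WeierstrassCurve ℚ} [Wd.IsElliptic] (Cd : VariableChange ℚ) (hWd : Cd • W.quadraticTwist (d : ℚ) = Wd) :
    (Wd.baseChange ℚ_[q]).localTamagawaNumber ℤ_[q] = 1 := by
  have hq' : Prime (q : ℤ) := Nat.prime_iff_prime_int.mp hq.out
  have h2 : ¬ (q : ℤ) ∣ 2 := fun h => by
    have : q ∣ 2 := by exact_mod_cast h
    exact hq2 ((Nat.prime_dvd_prime_iff_eq hq.out Nat.prime_two).mp this)
  set Jz : WeierstrassCurve ℤ := ⟨0, d * (integralModelInt W).b₂, 0, 8 * d ^ 2 * (integralModelInt W).b₄,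
    16 * d ^ 3 * (integralModelInt W).b₆⟩ with hJ
  set N : WeierstrassCurve ℤ_[q] := Jz.map (Int.castRingHom ℤ_[q]) with hN
  obtain ⟨s1, s2, s3, s4, s6⟩ := twistIntModel_padic_shape q W hd Jz hJ
  have hu : IsUnit (((2 ^ 12 * d₁ ^ 6 * minimalDiscriminantInt W : ℤ)) : ℤ_[q]) := by
    refine isUnit_intCast_padicInt_of_not_dvd q (z := 2 ^ 12 * d₁ ^ 6 * minimalDiscriminantInt W) fun h => ?_
    rcases hq'.dvd_or_dvd h with h | h
    · rcases hq'.dvd_or_dvd h with h | h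
      · exact h2 (hq'.dvd_of_dvd_pow h)
      · exact hd₁ (hq'.dvd_of_dvd_pow h)
    · exact hqΔ h
  have hΔeq : N.Δ = (q : ℤ_[q]) ^ 6 * (((2 ^ 12 * d₁ ^ 6 * minimalDiscriminantInt W : ℤ)) : ℤ_[q]) := by
    rw [hN, WeierstrassCurve.map_Δ, Δ_twistIntModel W d Jz hJ, hd, eq_intCast]
    push_cast
    ring
  haveI : WeierstrassCurve.IsIntegral ℤ_[q] (N.baseChange ℚ_[q]) := ⟨⟨_, rfl⟩⟩
  have hval : (IsDiscreteValuationRing.maximalIdeal ℤ_[q]).valuation ℚ_[q] (N.baseChange ℚ_[q]).Δ =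
      WithZero.exp (-(6 : ℕ) : ℤ) := by
    rw [WeierstrassCurve.baseChange, WeierstrassCurve.map_Δ, hΔeq]
    exact LocalIndex.valuation_algebraMap_pow_mul_of_isUnit PadicInt.irreducible_p hu 6
  haveI : (N.baseChange ℚ_[q]).IsMinimal ℤ_[q] :=
    WeierstrassCurve.isMinimal_of_exp_lt_valuation_Δ _ (by rw [hval, WithZero.exp_lt_exp]; norm_num)
  have hΔK : (N.baseChange ℚ_[q]).Δ ≠ 0 := by
    rw [WeierstrassCurve.baseChange, WeierstrassCurve.map_Δ, hΔeq]
    exact (map_ne_zero_iff _ (IsFractionRing.injective ℤ_[q] ℚ_[q])).mpr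
      (mul_ne_zero (pow_ne_zero _ PadicInt.irreducible_p.ne_zero) hu.ne_zero)
  haveI : (N.baseChange ℚ_[q]).IsElliptic := (WeierstrassCurve.isElliptic_iff _).mpr (Ne.isUnit hΔK)
  have h1N : (N.baseChange ℚ_[q]).localTamagawaNumber ℤ_[q] = 1 :=
    LocalIndex.localTamagawaNumber_baseChange_eq_one_of_cubic_no_root _
      PadicInt.irreducible_p s1 s2 s3 s4 s6 fun t ht => by
        obtain ⟨x, hx⟩ := exists_zmod_root_of_cubic_root q W hq2 hd₁ ht
        exact hno x hx
  set C₂ : VariableChange ℚ := ⟨Units.mk0 (2 : ℚ)⁻¹ (by norm_num), 0, 0, 0⟩ with hC₂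
  have hJQ : Jz.map (Int.castRingHom ℚ) = C₂ • W.quadraticTwist (d : ℚ) :=
    map_twistIntModel_eq_smul_quadraticTwist W d Jz hJ
  have hNK : N.baseChange ℚ_[q] = (Jz.map (Int.castRingHom ℚ)).baseChange ℚ_[q] := by
    rw [hN, WeierstrassCurve.baseChange, WeierstrassCurve.baseChange, WeierstrassCurve.map_map,
      WeierstrassCurve.map_map, RingHom.ext_int ((algebraMap ℚ ℚ_[q]).comp (Int.castRingHom ℚ))
        ((algebraMap ℤ_[q] ℚ_[q]).comp (Int.castRingHom ℤ_[q]))]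
  haveI : (Wd.baseChange ℚ_[q]).IsElliptic := inferInstanceAs (Wd.map (algebraMap ℚ ℚ_[q])).IsElliptic
  have hWdK : Wd.baseChange ℚ_[q] =
      (Cd.baseChange ℚ_[q] * (C₂.baseChange ℚ_[q])⁻¹) • N.baseChange ℚ_[q] := by
    rw [hNK, hJQ, WeierstrassCurve.baseChange_smul_eq, mul_smul, inv_smul_smul,
      ← WeierstrassCurve.baseChange_smul_eq, hWd]
  rw [localTamagawaNumber_eq_of_eq_smul q _ hWdK]
  exact h1N

/-! ## §10. The Tamagawa parity of a Heegner twin -/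

/-- A root of `ψ = 4x³ + b₂x² + 2b₄x + b₆` mod a prime `q ∤ 2Δ_min(W)` is simple (`disc ψ = 16Δ_min ≠ 0` mod `q`).
[cite: SilvermanAEC2009, III.1 (ψ₂, Δ)] -/
theorem twoTorsion_root_simple (W : WeierstrassCurve ℚ) [W.IsElliptic] [W.IsGloballyMinimal] {q : ℕ} [hq : Fact q.Prime]
    (hq2 : q ≠ 2) (hqΔ : ¬ (q : ℤ) ∣ minimalDiscriminantInt W) {x : ZMod q}
    (hx : 4 * x ^ 3 + ((integralModelInt W).b₂ : ZMod q) * x ^ 2 + 2 * ((integralModelInt W).b₄ : ZMod q) * x +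
      ((integralModelInt W).b₆ : ZMod q) = 0) :
    12 * x ^ 2 + 2 * ((integralModelInt W).b₂ : ZMod q) * x + 2 * ((integralModelInt W).b₄ : ZMod q) ≠ 0 := by
  set M : WeierstrassCurve (ZMod q) := (integralModelInt W).map (Int.castRingHom (ZMod q)) with hM
  have h2 : (2 : ZMod q) ≠ 0 := by
    have : ((2 : ℕ) : ZMod q) ≠ 0 := by
      rw [Ne, ZMod.natCast_eq_zero_iff]
      intro h
      exact hq2 ((Nat.prime_dvd_prime_iff_eq hq.out Nat.prime_two).mp h)
    exact_mod_cast this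
  have hΔM : M.Δ = ((minimalDiscriminantInt W : ℤ) : ZMod q) := by
    rw [hM, WeierstrassCurve.map_Δ, minimalDiscriminantInt, eq_intCast]
  have hΔ0 : M.Δ ≠ 0 := by
    rw [hΔM, Ne, ZMod.intCast_zmod_eq_zero_iff_dvd]
    exact hqΔ
  have hdisc0 : M.twoTorsionPolynomial.discr ≠ 0 := by
    rw [WeierstrassCurve.twoTorsionPolynomial_discr]
    have h16 : (16 : ZMod q) ≠ 0 := by
      have : (16 : ZMod q) = 2 * 2 * 2 * 2 := by norm_num
      rw [this]
      exact mul_ne_zero (mul_ne_zero (mul_ne_zero h2 h2) h2) h2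
    exact mul_ne_zero h16 hΔ0
  have ha : M.twoTorsionPolynomial.a ≠ 0 := by
    show (4 : ZMod q) ≠ 0
    have : (4 : ZMod q) = 2 * 2 := by norm_num
    rw [this]; exact mul_ne_zero h2 h2
  have hb₂ : M.b₂ = ((integralModelInt W).b₂ : ZMod q) := by rw [hM, WeierstrassCurve.map_b₂, eq_intCast]
  have hb₄ : M.b₄ = ((integralModelInt W).b₄ : ZMod q) := by rw [hM, WeierstrassCurve.map_b₄, eq_intCast]
  have hb₆ : M.b₆ = ((integralModelInt W).b₆ : ZMod q) := by rw [hM, WeierstrassCurve.map_b₆, eq_intCast]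
  have hroot : M.twoTorsionPolynomial.toPoly.IsRoot x := by
    rw [Polynomial.IsRoot.def]
    simp only [WeierstrassCurve.twoTorsionPolynomial, Cubic.toPoly, Polynomial.eval_add, Polynomial.eval_mul,
      Polynomial.eval_C, Polynomial.eval_pow, Polynomial.eval_X, hb₂, hb₄, hb₆]
    linear_combination hx
  have hx' := eval_derivative_ne_zero_of_discr_ne_zero M.twoTorsionPolynomial ha hdisc0 hroot
  intro h0
  apply hx'
  simp only [WeierstrassCurve.twoTorsionPolynomial, Cubic.toPoly, Polynomial.derivative_add, Polynomial.derivative_mul,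
    Polynomial.derivative_C, Polynomial.derivative_X_pow, Polynomial.derivative_X, Polynomial.eval_add,
    Polynomial.eval_mul, Polynomial.eval_C, Polynomial.eval_pow, Polynomial.eval_X, zero_mul, add_zero, zero_add, mul_one,
    hb₂, hb₄, hb₆]
  push_cast
  linear_combination h0

/-- **Tamagawa parity of a Heegner twin.** `W/ℚ` globally minimal, `K` imaginary quadratic with ODD `d_K` satisfying the
Heegner hypothesis for `N_W`, `Wd` any `ℚ`-model of `W^{(d_K)}`. Then
`Tam(Wd)` is odd **iff** `Tam(W)` is odd **and** at every prime `q ∣ d_K` the `2`-division cubic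
`ψ = 4x³ + b₂x² + 2b₄x + b₆` of the minimal model has NO root mod `q` (every prime of `d_K` is «silent», `Ẽ(𝔽_q)[2] = 0`).
Ingredients: `c_ℓ(Wd) = c_ℓ(W)` at `ℓ ∣ N` (§7); `c_ℓ(Wd) = c_ℓ(W) = 1` off `N·d_K` (§8; `d_K ≡ 1 (mod 4)`); at `q ∣ d_K`
(`q ∥ d_K`, odd, `q ∤ N`): `c_q(Wd) = 1` without a root (§9) and `2 ∣ c_q(Wd)` with one (companion file; the root is simple,
`twoTorsion_root_simple`; `Odd ∏ ↔ ∀ Odd` via `Prime.dvd_finsetProd_iff`). This is the kernel-checked form of the census formula of TWIN-TAM-W52D (gk2-p4):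
`c_p(E^{(d_K)}) = 1 + #{roots of ψ mod p}` in parity. [cite: BoxerDiao2010, proof of Prop. 4.1 (p. 1977)]
[cite: SilvermanATAEC1994, IV.9.4 Step 6 (PDF p. 345)] -/
theorem odd_tamagawaProduct_twin_iff (W : WeierstrassCurve ℚ) [W.IsElliptic] [W.IsGloballyMinimal]
    {K : Type} [Field K] [NumberField K] (hK : IsImaginaryQuadratic K) (hodd : Odd (discr K))
    (hH : SatisfiesHeegnerHypothesis (W.conductorNorm ℤ) K) {Wd : WeierstrassCurve ℚ} [Wd.IsElliptic]
    (Cd : VariableChange ℚ) (hWd : Cd • W.quadraticTwist (discr K : ℚ) = Wd) :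
    Odd Wd.tamagawaProduct ↔ Odd W.tamagawaProduct ∧
      ∀ (q : ℕ) [Fact q.Prime], (q : ℤ) ∣ discr K → ∀ x : ZMod q,
        4 * x ^ 3 + ((integralModelInt W).b₂ : ZMod q) * x ^ 2 + 2 * ((integralModelInt W).b₄ : ZMod q) * x +
          ((integralModelInt W).b₆ : ZMod q) ≠ 0 := by
  have hd4 : discr K % 4 = 1 := Literature.NumberTheory.QuadraticFields.Quadratic.discr_emod_four_eq_one hK.1 hodd
  -- a product of naturals is odd iff every factor is odd
  have odd_prod_iff : ∀ (s : Finset (IsDedekindDomain.HeightOneSpectrum ℤ)) (f : IsDedekindDomain.HeightOneSpectrum ℤ → ℕ),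
      Odd (∏ i ∈ s, f i) ↔ ∀ i ∈ s, Odd (f i) := fun s f => by
    simp only [← Nat.not_even_iff_odd, even_iff_two_dvd, Nat.prime_two.prime.dvd_finsetProd_iff, not_exists, not_and]
  -- local facts at a prime `ℓ`
  have hloc : ∀ (ℓ : ℕ) [Fact ℓ.Prime],
      ((ℓ ∣ W.conductorNorm ℤ) →
        (Wd.baseChange ℚ_[ℓ]).localTamagawaNumber ℤ_[ℓ] = (W.baseChange ℚ_[ℓ]).localTamagawaNumber ℤ_[ℓ]) ∧
      (¬ ℓ ∣ W.conductorNorm ℤ → (W.baseChange ℚ_[ℓ]).localTamagawaNumber ℤ_[ℓ] = 1) ∧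
      (¬ ℓ ∣ W.conductorNorm ℤ → ¬ (ℓ : ℤ) ∣ discr K → (Wd.baseChange ℚ_[ℓ]).localTamagawaNumber ℤ_[ℓ] = 1) := by
    intro ℓ _
    refine ⟨fun hℓN => localTamagawaNumber_twin_eq_of_dvd_conductorNorm W hK hH Cd hWd ℓ hℓN, fun hℓN => ?_,
      fun hℓN hℓd => ?_⟩
    · have hgood : W.HasGoodReductionAtPrime ℓ := by
        by_contra h; exact hℓN ((W.dvd_conductorNorm_iff_not_hasGoodReductionAtPrime ℓ).mpr h)
      haveI : (W.baseChange ℚ_[ℓ]).IsElliptic := inferInstanceAs (W.map (algebraMap ℚ ℚ_[ℓ])).IsElliptic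
      haveI : ((W.baseChange ℚ_[ℓ]).minimal ℤ_[ℓ]).HasGoodReduction ℤ_[ℓ] := hgood
      exact localTamagawaNumber_eq_one_of_hasGoodReduction_holds ℤ_[ℓ] _
    · have hgood : W.HasGoodReductionAtPrime ℓ := by
        by_contra h; exact hℓN ((W.dvd_conductorNorm_iff_not_hasGoodReductionAtPrime ℓ).mpr h)
      exact localTamagawaNumber_twist_eq_one_of_not_dvd W hd4 Cd hWd ℓ hgood hℓd
  -- at a prime `q ∣ d_K`: `q` odd, `q ∤ N`, `q ∥ d_K`, `q ∤ Δ_min`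
  have hdK : ∀ (q : ℕ) [Fact q.Prime], (q : ℤ) ∣ discr K →
      q ≠ 2 ∧ ¬ q ∣ W.conductorNorm ℤ ∧ ¬ (q : ℤ) ∣ minimalDiscriminantInt W ∧
        ∃ d₁ : ℤ, discr K = q * d₁ ∧ ¬ (q : ℤ) ∣ d₁ := by
    intro q hq hqd
    have hq2 : q ≠ 2 := by
      rintro rfl
      exact (Int.not_even_iff_odd.mpr hodd) (even_iff_two_dvd.mpr (by exact_mod_cast hqd))
    have hqN : ¬ q ∣ W.conductorNorm ℤ := fun hqN =>
      Literature.SatisfiesHeegnerHypothesis.not_dvd_discr hK.1 hH hq.out hqN hqd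
    refine ⟨hq2, hqN, fun hqΔ => hqN (dvd_conductorNorm_of_dvd_minimalDiscriminantInt W hq.out hqΔ), ?_⟩
    obtain ⟨d₁, hd⟩ := hqd
    refine ⟨d₁, hd, ?_⟩
    rintro ⟨e, rfl⟩
    exact Literature.NumberTheory.QuadraticFields.Quadratic.not_sq_dvd_discr_of_prime_ne_two hK.1 hq.out hq2
      ⟨e, by rw [hd]; ring⟩
  -- the common finite set of places
  have hfW : (W.badPlaces ℤ).Finite := W.finite_badPlaces_holds ℤ
  have hfWd : (Wd.badPlaces ℤ).Finite := Wd.finite_badPlaces_holds ℤ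
  set s : Finset (IsDedekindDomain.HeightOneSpectrum ℤ) := hfW.toFinset ∪ hfWd.toFinset with hs
  have hsW : ∀ v, ¬ W.HasGoodReductionAt v → v ∈ s := fun v hv ↦
    Finset.mem_union_left _ (by rw [Set.Finite.mem_toFinset, mem_badPlaces_iff]; exact hv)
  have hsWd : ∀ v, ¬ Wd.HasGoodReductionAt v → v ∈ s := fun v hv ↦
    Finset.mem_union_right _ (by rw [Set.Finite.mem_toFinset, mem_badPlaces_iff]; exact hv)
  constructor
  · intro hT
    refine ⟨?_, fun q _ hqd x hx => ?_⟩
    · rw [tamagawaProduct_eq_prod Wd s hsWd, odd_prod_iff] at hT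
      rw [tamagawaProduct_eq_prod W s hsW, odd_prod_iff]
      intro v hv
      haveI := Fact.mk (primesEquiv v).2
      have hv' := hT v hv
      by_cases hℓN : (primesEquiv v : ℕ) ∣ W.conductorNorm ℤ
      · rw [← (hloc (primesEquiv v)).1 hℓN]; exact hv'
      · rw [(hloc (primesEquiv v)).2.1 hℓN]; exact odd_one
    · -- a root at `q ∣ d_K` makes `c_q(Wd)` even, contradicting `Odd Tam(Wd)`
      obtain ⟨hq2, -, hqΔ, d₁, hd, hd₁⟩ := hdK q hqd
      have hx' := twoTorsion_root_simple W hq2 hqΔ hx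
      have h2c : 2 ∣ (Wd.baseChange ℚ_[q]).localTamagawaNumber ℤ_[q] :=
        two_dvd_localTamagawaNumber_twist_of_root q hq2 W hd hd₁ hqΔ hx hx' Cd hWd
      have hq : q.Prime := Fact.out
      set v : IsDedekindDomain.HeightOneSpectrum ℤ := primesEquiv.symm ⟨q, hq⟩ with hv
      set s' : Finset (IsDedekindDomain.HeightOneSpectrum ℤ) := hfWd.toFinset ∪ {v} with hs'
      have hs'Wd : ∀ w, ¬ Wd.HasGoodReductionAt w → w ∈ s' := fun w hw ↦
        Finset.mem_union_left _ (by rw [Set.Finite.mem_toFinset, mem_badPlaces_iff]; exact hw)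
      rw [tamagawaProduct_eq_prod Wd s' hs'Wd] at hT
      have h2T : 2 ∣ ∏ w ∈ s', (haveI := Fact.mk (primesEquiv w).2;
          (Wd.baseChange ℚ_[primesEquiv w]).localTamagawaNumber ℤ_[primesEquiv w]) := by
        refine dvd_trans ?_ (Finset.dvd_prod_of_mem _ (Finset.mem_union_right _ (Finset.mem_singleton_self v)))
        have hpv : primesEquiv v = ⟨q, hq⟩ := by rw [hv, Equiv.apply_symm_apply]
        generalize primesEquiv v = P at hpv ⊢
        subst hpv
        exact h2c
      exact (Nat.not_even_iff_odd.mpr hT) (even_iff_two_dvd.mpr h2T)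
  · rintro ⟨hT, hno⟩
    rw [tamagawaProduct_eq_prod W s hsW, odd_prod_iff] at hT
    rw [tamagawaProduct_eq_prod Wd s hsWd, odd_prod_iff]
    intro v hv
    haveI := Fact.mk (primesEquiv v).2
    by_cases hℓN : (primesEquiv v : ℕ) ∣ W.conductorNorm ℤ
    · rw [(hloc (primesEquiv v)).1 hℓN]; exact hT v hv
    · by_cases hℓd : ((primesEquiv v : ℕ) : ℤ) ∣ discr K
      · obtain ⟨hq2, -, hqΔ, d₁, hd, hd₁⟩ := hdK (primesEquiv v) hℓd
        rw [localTamagawaNumber_twist_eq_one_of_no_root (primesEquiv v) hq2 W hd hd₁ hqΔ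
          (hno (primesEquiv v) hℓd) Cd hWd]
        exact odd_one
      · rw [(hloc (primesEquiv v)).2.2 hℓN hℓd]; exact odd_one

end Summit.BirchSwinnertonDyer.BirchSwinnertonDyer.Theorems.GenusKolyTwin

end
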